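import Mathlib.Analysis.Complex.Schwarz
import Mathlib.Analysis.Complex.BorelCaratheodory
import Mathlib.Analysis.Complex.OpenMapping
import Mathlib.Analysis.Complex.Liouville
import Mathlib.Analysis.Complex.Convex
import Mathlib.Analysis.SpecialFunctions.Trigonometric.Complex
import Literature.Analysis.TotalPositivity.PolyaFrequencyEntireZeros
import HarnessLib

/-!
# Edrei's theorem: a zero-free entire PF generating function is `e^{γz}` — proved;
# the Aissen–Schoenberg–Whitney–Edrei representation `aswe_edrei` — discharged

Trunk T-ANALYSIS (Literature/Analysis/TotalPositivity). Last part of the decomposition of the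
named fact `Literature.Analysis.TotalPositivity.aswe_edrei` (PolyaFrequency.lean; [Karlin1968,
Ch. 8, Thm. 5.3] = [AissenEdreiSchoenbergWhitney1951, Thm. 4]). We DISCHARGE the named fact
`edrei1952_exponential_factor` (ASWERepresentation.lean) = [AissenEdreiSchoenbergWhitney1951,
Thm. 3] (Edrei 1952): if `g` is entire, `g(0) = 0`, and `e^{g}` generates a Pólya frequency
sequence, then `g(z) = γz` with `γ ≥ 0`; and hence `aswe_edrei_holds : aswe_edrei`.

## The proof

Edrei's printed proof [Edrei1953, §4, pp. 92–94] (like the original one, [Edrei1952], which by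
[AissenEdreiSchoenbergWhitney1951, p. 305] combines Theorem 2 "with a refinement of the Picard
theorem for entire functions due to R. Nevanlinna") kills the odd Taylor coefficients `γ₃, γ₅, …`
of `g` with R. Nevanlinna's theorem on meromorphic functions three of whose values have finite
exponent of convergence [Edrei1953, p. 93, ref. [4, p. 72]], and then the even ones by a
maximum-modulus argument [Edrei1953, pp. 93–94]. We keep Edrei's two devices — the total
positivity of the even-indexed subsequence `(a₂ₙ)` [Edrei1953, §4, first sentence, p. 92] and the
fact that `e^{g(z)}` and `1/e^{g(-z)} = e^{-g(-z)}` both have non-negative Taylor coefficients (the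
reciprocal rule), so that their maximum modulus is attained on the positive axis — but replace
Nevanlinna theory by the following elementary argument. Let `u` be the PF Taylor sequence of
`f = e^{g}`, `v = negRecipSeq u` (PF) that of `h(z) = e^{-g(-z)}`, `w = u ⋆ v` (PF) that of
`W = f h = e^{G}`, `G(z) = g(z) - g(-z)`.

1. For every `m ≥ 1`, `cosh(m G(z)) = 0 ⇒ Re z = 0`
   (`IsPolyaFrequencySeq.re_eq_zero_of_pow_add_pow`, PolyaFrequencyEntireZeros.lean:
   `2cosh(mG) = Wᵐ(z) + Wᵐ(-z)` is twice the generating function, in `z²`, of the even subsequence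
   of the PF sequence `w^{⋆m}`, an entire PF generating function, whose zeros are negative reals by
   Aissen–Schoenberg–Whitney's Theorem 2).
2. Hence `Re G(z) ≠ 0` whenever `Re z ≠ 0` (unless `G` is constant): `G` is open at such a `z`, and
   the values `iπ(2ℓ+1)/(2m)` are dense in `iℝ` (`Edrei.re_ne_zero_or_const`).
3. `|W(-x)| ≤ W(x)` for `x ≥ 0` (non-negative coefficients) gives `Re G(x) ≥ 0`, so `Re G > 0`
   on the right half-plane (connectedness), and the Schwarz lemma for `(G - a)/(G + ā)` on the disc
   `|z - 2r| < 2r` gives the doubling bound `‖G(2r)‖ ≤ 3‖G(r)‖` (`Edrei.norm_le_three_mul_norm`).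
4. `|f(z)| ≤ f(|z|) ≤ f(|z|)h(|z|) = e^{G(|z|)}`, so `Re g(z) ≤ ‖G(R)‖` on `‖z‖ < R`, with
   `‖G(4ʲ)‖ ≤ 9ʲ‖G(1)‖`; Borel–Carathéodory (`Complex.borelCaratheodory_zero`) and Cauchy's
   estimates (`Complex.norm_iteratedDeriv_le_of_forall_mem_sphere_norm_le`) give
   `|g⁽ⁿ⁾(0)| ≤ n!·C·(9/4ⁿ)ʲ → 0` for `n ≥ 2`, so `g(z) = γz` (`Edrei.eq_smul_of_re_le`), and
   `γ = u₁ ≥ 0`.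

## Main results

* `Edrei.re_ne_zero_or_const`, `Edrei.norm_le_three_mul_norm`, `Edrei.eq_smul_of_re_le` — the
  three analytic lemmas (steps 2, 3, 4), in the sub-namespace `Edrei`.
* `edrei1952_exponential_factor_holds : edrei1952_exponential_factor` — Edrei's Theorem 3.
* `aswe_edrei_holds : aswe_edrei` — the representation theorem, unconditionally.

## References

* A. Edrei, *On the generating functions of totally positive sequences II*, J. Analyse Math. 2
  (1952) 104–109. [Edrei1952]
* A. Edrei, *Proof of a conjecture of Schoenberg on the generating function of a totally positive
  sequence*, Canad. J. Math. 5 (1953) 86–94, §4. [Edrei1953]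
* M. Aissen, A. Edrei, I. J. Schoenberg, A. Whitney, Proc. Nat. Acad. Sci. USA 37 (1951)
  303–307, Thms. 3, 4. [AissenEdreiSchoenbergWhitney1951]
* S. Karlin, *Total Positivity I*, Stanford UP 1968, Ch. 8, Thm. 5.3. [Karlin1968]
-/

noncomputable section

open Filter Complex Metric Set
open scoped Topology Nat Real

namespace Literature.Analysis.TotalPositivity

/-! ### A. Step 2: an open-mapping argument -/

namespace Edrei

/-- **If `cosh(mG)` vanishes only on the imaginary axis for every `m ≥ 1`, then `Re G ≠ 0` off
the imaginary axis** (or `G` is constant). At a point `z` with `Re z ≠ 0` and `Re G(z) = 0`, the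
open mapping theorem makes `G` attain, at points `w` near `z` (so `Re w ≠ 0`), every value
`it'` with `t'` close to `Im G(z)`, in particular a value `iπ(2ℓ+1)/(2m)`, where `cosh(mG(w)) = 0`.
[folklore] -/
theorem re_ne_zero_or_const {G : ℂ → ℂ} (hG : Differentiable ℂ G)
    (h : ∀ m : ℕ, 0 < m → ∀ z : ℂ, Complex.cosh (m * G z) = 0 → z.re = 0) :
    (∀ z : ℂ, z.re ≠ 0 → (G z).re ≠ 0) ∨ ∀ z, G z = G 0 := by
  classical
  by_cases hc : ∀ z, G z = G 0
  · exact Or.inr hc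
  refine Or.inl fun z hz hre => ?_
  push Not at hc
  obtain ⟨z₁, hz₁⟩ := hc
  rcases (hG.analyticAt z).eventually_constant_or_nhds_le_map_nhds with h1 | h2
  · -- `G` locally constant near `z`, hence constant: contradiction
    have hconst : EqOn G (fun _ => G z) univ :=
      (analyticOnNhd_univ_iff_differentiable.2 hG).eqOn_of_preconnected_of_eventuallyEq
        analyticOnNhd_const isPreconnected_univ (mem_univ z) h1
    exact hz₁ (by rw [hconst (mem_univ z₁), hconst (mem_univ 0)])
  · -- the open mapping theorem at `z`
    set U : Set ℂ := {w | w.re ≠ 0} with hU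
    have hUo : IsOpen U := isOpen_ne_fun Complex.continuous_re continuous_const
    have hUz : U ∈ 𝓝 z := hUo.mem_nhds hz
    have hGU : G '' U ∈ 𝓝 (G z) := h2 (image_mem_map hUz)
    obtain ⟨ε, hε, hball⟩ := Metric.mem_nhds_iff.1 hGU
    -- an `m` with `π/m < ε` and the nearest point `iπ(2ℓ+1)/(2m)`
    obtain ⟨m, hm⟩ := exists_nat_gt (π / ε)
    have hm0 : 0 < m := by
      have : (0 : ℝ) < m := lt_trans (div_pos Real.pi_pos hε) hm
      exact_mod_cast this
    have hmR : (0 : ℝ) < m := by exact_mod_cast hm0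
    have hπm : π / m < ε := by
      rw [div_lt_iff₀ hmR]
      rw [div_lt_iff₀ hε] at hm
      linarith [mul_comm (m : ℝ) ε]
    set t : ℝ := (G z).im with ht
    set ℓ : ℤ := ⌊t * m / π⌋ with hℓ
    set q : ℝ := π * (2 * ℓ + 1) / (2 * m) with hq
    have hqt : |q - t| < ε := by
      have h1 : (ℓ : ℝ) ≤ t * m / π := Int.floor_le _
      have h2 : t * m / π < ℓ + 1 := Int.lt_floor_add_one _
      have e1 : q - t = π / m * (ℓ + 1 / 2 - t * m / π) := by
        rw [hq]
        field_simp
      rw [e1, abs_mul, abs_of_pos (div_pos Real.pi_pos hmR)]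
      have h3 : |(ℓ : ℝ) + 1 / 2 - t * m / π| ≤ 1 / 2 := by
        rw [abs_le]; constructor <;> linarith
      calc π / m * |(ℓ : ℝ) + 1 / 2 - t * m / π| ≤ π / m * 1 := by
            refine mul_le_mul_of_nonneg_left (h3.trans (by norm_num)) (div_pos Real.pi_pos hmR).le
        _ < ε := by rw [mul_one]; exact hπm
    have hGz : G z = (t : ℂ) * I := by
      apply Complex.ext
      · simp [hre]
      · simp [ht]
    have hmem : (q : ℂ) * I ∈ Metric.ball (G z) ε := by
      rw [Metric.mem_ball, hGz, dist_eq_norm]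
      have : (q : ℂ) * I - (t : ℂ) * I = ((q - t : ℝ) : ℂ) * I := by push_cast; ring
      rw [this, norm_mul, Complex.norm_I, mul_one, Complex.norm_real, Real.norm_eq_abs]
      exact hqt
    obtain ⟨w, hwU, hGw⟩ := hball hmem
    -- `cosh(m G(w)) = cos(m q) = 0`
    have hcosh : Complex.cosh (m * G w) = 0 := by
      rw [hGw, show (m : ℂ) * ((q : ℂ) * I) = ((m * q : ℝ) : ℂ) * I by push_cast; ring,
        Complex.cosh_mul_I, Complex.cos_eq_zero_iff]
      refine ⟨ℓ, ?_⟩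
      have hm' : (m : ℂ) ≠ 0 := by exact_mod_cast hm0.ne'
      rw [hq]
      push_cast
      field_simp
    exact hwU (h m hm0 w hcosh)

/-- **`Re G` keeps a strict sign on the right half-plane** once it does not vanish there and is
positive at one point (connectedness of the half-plane). [folklore] -/
theorem re_pos_of_re_ne_zero {G : ℂ → ℂ} (hG : Continuous G)
    (h : ∀ z : ℂ, z.re ≠ 0 → (G z).re ≠ 0) {z₀ : ℂ} (hz₀ : 0 < z₀.re) (hpos : 0 < (G z₀).re)
    {z : ℂ} (hz : 0 < z.re) : 0 < (G z).re := by
  by_contra hle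
  push Not at hle
  have hlt : (G z).re < 0 := lt_of_le_of_ne hle (h z hz.ne')
  have hconn : IsPreconnected {c : ℂ | 0 < c.re} := (convex_halfSpace_re_gt 0).isPreconnected
  have hcont : ContinuousOn (fun c => (G c).re) {c : ℂ | 0 < c.re} :=
    (Complex.continuous_re.comp hG).continuousOn
  have := hconn.intermediate_value hz hz₀ hcont ⟨hlt.le, hpos.le⟩
  obtain ⟨c, hc, hc0⟩ := this
  exact h c (ne_of_gt hc) hc0

/-! ### B. Step 3: the doubling bound from the Schwarz lemma -/

/-- **Harnack-type doubling.** If `G` is holomorphic with `Re G > 0` on the disc `|z - 2r| < 2r`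
(`r > 0`), then `‖G(2r)‖ ≤ 3 ‖G(r)‖`: the Cayley transform `(G - a)/(G + ā)`, `a = G(2r)`, maps the
disc into the closed unit disc and vanishes at the centre, so by the Schwarz lemma its modulus at
`r` is `≤ 1/2`, i.e. `2|G(r) - a| ≤ |G(r) + ā| ≤ |G(r)| + |a|`. [folklore] -/
theorem norm_le_three_mul_norm {G : ℂ → ℂ} {r : ℝ} (hr : 0 < r)
    (hd : DifferentiableOn ℂ G (ball ((2 * r : ℝ) : ℂ) (2 * r)))
    (hpos : ∀ z ∈ ball ((2 * r : ℝ) : ℂ) (2 * r), 0 < (G z).re) :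
    ‖G ((2 * r : ℝ) : ℂ)‖ ≤ 3 * ‖G (r : ℂ)‖ := by
  set c : ℂ := ((2 * r : ℝ) : ℂ) with hc
  set a : ℂ := G c with ha
  have hcmem : c ∈ ball c (2 * r) := mem_ball_self (by linarith)
  have hare : 0 < a.re := hpos c hcmem
  -- the Cayley transform
  have hden : ∀ z ∈ ball c (2 * r), G z + (starRingEnd ℂ) a ≠ 0 := by
    intro z hz h0
    have := congrArg Complex.re h0
    simp only [Complex.add_re, Complex.conj_re, Complex.zero_re] at this
    linarith [hpos z hz]
  have hkey : ∀ w : ℂ, 0 < w.re → ‖w - a‖ ≤ ‖w + (starRingEnd ℂ) a‖ := by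
    intro w hw
    rw [← sq_le_sq₀ (norm_nonneg _) (norm_nonneg _), Complex.sq_norm, Complex.sq_norm,
      Complex.normSq_apply, Complex.normSq_apply]
    simp only [Complex.sub_re, Complex.sub_im, Complex.add_re, Complex.add_im, Complex.conj_re,
      Complex.conj_im]
    nlinarith [mul_pos hw hare]
  set T : ℂ → ℂ := fun z => (G z - a) / (G z + (starRingEnd ℂ) a) with hT
  have hTd : DifferentiableOn ℂ T (ball c (2 * r)) :=
    (hd.sub_const a).div (hd.add_const _) hden
  have hTc : T c = 0 := by simp [hT, ha]
  have hmaps : MapsTo T (ball c (2 * r)) (closedBall (T c) 1) := by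
    intro z hz
    rw [hTc, mem_closedBall, dist_zero_right, hT]
    simp only
    rw [norm_div, div_le_one (norm_pos_iff.2 (hden z hz))]
    exact hkey (G z) (hpos z hz)
  have hrmem : (r : ℂ) ∈ ball c (2 * r) := by
    rw [mem_ball, hc, dist_eq_norm, show (r : ℂ) - ((2 * r : ℝ) : ℂ) = ((-r : ℝ) : ℂ) by
      push_cast; ring, Complex.norm_real, Real.norm_eq_abs, abs_neg, abs_of_pos hr]
    linarith
  have hS := Complex.dist_le_div_mul_dist_of_mapsTo_ball hTd hmaps hrmem
  rw [hTc, dist_zero_right] at hS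
  have hdist : dist (r : ℂ) c = r := by
    rw [hc, dist_eq_norm, show (r : ℂ) - ((2 * r : ℝ) : ℂ) = ((-r : ℝ) : ℂ) by push_cast; ring,
      Complex.norm_real, Real.norm_eq_abs, abs_neg, abs_of_pos hr]
  rw [hdist, show (1 : ℝ) / (2 * r) * r = 1 / 2 by field_simp] at hS
  -- unwind: `2 ‖G r - a‖ ≤ ‖G r + ā‖ ≤ ‖G r‖ + ‖a‖`
  set b : ℂ := G (r : ℂ) with hb
  have hbre : 0 < b.re := hpos _ hrmem
  have h1 : ‖b - a‖ ≤ 1 / 2 * ‖b + (starRingEnd ℂ) a‖ := by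
    have hne := hden _ hrmem
    rw [hT] at hS
    simp only at hS
    rw [norm_div, div_le_iff₀ (norm_pos_iff.2 hne)] at hS
    exact hS
  have h2 : ‖b + (starRingEnd ℂ) a‖ ≤ ‖b‖ + ‖a‖ := by
    calc ‖b + (starRingEnd ℂ) a‖ ≤ ‖b‖ + ‖(starRingEnd ℂ) a‖ := norm_add_le _ _
      _ = ‖b‖ + ‖a‖ := by rw [Complex.norm_conj]
  have h3 : ‖a‖ - ‖b‖ ≤ ‖b - a‖ := by
    have := norm_sub_norm_le a b
    rwa [norm_sub_rev] at this
  linarith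

/-! ### C. Step 4: polynomial growth of `Re g` forces `g` linear -/

/-- **Borel–Carathéodory + Cauchy.** Let `g` be entire with `g(0) = 0` and suppose
`Re g(z) ≤ A(R)` for `‖z‖ < R`, where `A ≥ 0` satisfies the doubling bound `A(2R) ≤ 3A(R)`
(`R > 0`). Then `g(z) = g'(0) z`: Borel–Carathéodory bounds `‖g‖` by `2(A(2·4ʲ)+1) ≤ 2(3·9ʲA(1)+1)`
on the sphere of radius `4ʲ`, and Cauchy's estimate gives `‖g⁽ⁿ⁾(0)‖ ≤ n!·2(3A(1)+1)·(9/4ⁿ)ʲ → 0`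
for `n ≥ 2`. [folklore] -/
theorem eq_smul_of_re_le {g : ℂ → ℂ} (hg : Differentiable ℂ g) (h0 : g 0 = 0) (A : ℝ → ℝ)
    (hA0 : ∀ R, 0 < R → 0 ≤ A R) (hA2 : ∀ R, 0 < R → A (2 * R) ≤ 3 * A R)
    (hre : ∀ R, 0 < R → ∀ z : ℂ, ‖z‖ < R → (g z).re ≤ A R) :
    ∀ z, g z = deriv g 0 * z := by
  -- (i) `‖g‖ ≤ 2(A(2ρ)+1)` on the sphere of radius `ρ`
  have hBC : ∀ ρ, 0 < ρ → ∀ z ∈ sphere (0 : ℂ) ρ, ‖g z‖ ≤ 2 * (A (2 * ρ) + 1) := by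
    intro ρ hρ z hz
    have hM : 0 < A (2 * ρ) + 1 := by linarith [hA0 (2 * ρ) (by linarith)]
    have hzn : ‖z‖ = ρ := by simpa using hz
    have hzb : z ∈ ball (0 : ℂ) (2 * ρ) := by
      rw [mem_ball, dist_zero_right, hzn]; linarith
    have h := Complex.borelCaratheodory_zero hM hg.differentiableOn
      (fun w hw => by
        have : ‖w‖ < 2 * ρ := by simpa using hw
        exact (hre (2 * ρ) (by linarith) w this).trans (by linarith))
      (by linarith) hzb h0
    rw [hzn, show 2 * ρ - ρ = ρ by ring] at h
    calc ‖g z‖ ≤ 2 * (A (2 * ρ) + 1) * ρ / ρ := h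
      _ = 2 * (A (2 * ρ) + 1) := by field_simp
  -- (ii) `A(4ʲ) ≤ 9ʲ A(1)`
  have hA4 : ∀ j : ℕ, A (4 ^ j) ≤ 9 ^ j * A 1 := by
    intro j
    induction j with
    | zero => simp
    | succ j ih =>
      have h4 : (0 : ℝ) < 4 ^ j := by positivity
      calc A (4 ^ (j + 1)) = A (2 * (2 * 4 ^ j)) := by ring_nf
        _ ≤ 3 * A (2 * 4 ^ j) := hA2 _ (by positivity)
        _ ≤ 3 * (3 * A (4 ^ j)) := by linarith [hA2 _ h4]
        _ ≤ 3 * (3 * (9 ^ j * A 1)) := by nlinarith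
        _ = 9 ^ (j + 1) * A 1 := by ring
  -- (iii) Cauchy's estimate at radius `4ʲ`: `‖g⁽ⁿ⁾(0)‖ ≤ n! · 2(3A(1)+1) · (9/4ⁿ)ʲ`
  have hA1 : 0 ≤ A 1 := hA0 1 one_pos
  have hcauchy : ∀ (n j : ℕ), ‖iteratedDeriv n g 0‖ ≤
      n ! * (2 * (3 * A 1 + 1)) * ((9 : ℝ) / 4 ^ n) ^ j := by
    intro n j
    have hρ : (0 : ℝ) < 4 ^ j := by positivity
    have h := Complex.norm_iteratedDeriv_le_of_forall_mem_sphere_norm_le (c := 0) n hρ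
      hg.diffContOnCl (hBC (4 ^ j) hρ)
    have hb : 2 * (A (2 * 4 ^ j) + 1) ≤ 2 * (3 * A 1 + 1) * 9 ^ j := by
      have h1 : A (2 * 4 ^ j) ≤ 3 * A (4 ^ j) := hA2 _ hρ
      have h2 := hA4 j
      have h9 : (1 : ℝ) ≤ 9 ^ j := one_le_pow₀ (by norm_num)
      nlinarith
    calc ‖iteratedDeriv n g 0‖ ≤ n ! * (2 * (A (2 * 4 ^ j) + 1)) / (4 ^ j) ^ n := h
      _ ≤ n ! * (2 * (3 * A 1 + 1) * 9 ^ j) / (4 ^ j) ^ n := by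
          gcongr
      _ = n ! * (2 * (3 * A 1 + 1)) * ((9 : ℝ) / 4 ^ n) ^ j := by
          rw [div_pow, ← pow_mul, ← pow_mul, mul_comm j n]
          ring
  -- (iv) hence `g⁽ⁿ⁾(0) = 0` for `n ≥ 2`
  have hvanish : ∀ n : ℕ, 2 ≤ n → iteratedDeriv n g 0 = 0 := by
    intro n hn
    have hq : (9 : ℝ) / 4 ^ n < 1 := by
      rw [div_lt_one (by positivity)]
      calc (9 : ℝ) < 4 ^ 2 := by norm_num
        _ ≤ 4 ^ n := pow_le_pow_right₀ (by norm_num) hn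
    have hq0 : (0 : ℝ) ≤ 9 / 4 ^ n := by positivity
    have ht : Tendsto (fun j : ℕ => (n ! : ℝ) * (2 * (3 * A 1 + 1)) * ((9 : ℝ) / 4 ^ n) ^ j)
        atTop (𝓝 0) := by
      have := (tendsto_pow_atTop_nhds_zero_of_lt_one hq0 hq).const_mul
        ((n ! : ℝ) * (2 * (3 * A 1 + 1)))
      simpa using this
    have hle : ‖iteratedDeriv n g 0‖ ≤ 0 :=
      ge_of_tendsto ht (Eventually.of_forall fun j => hcauchy n j)
    exact norm_le_zero_iff.1 hle
  -- (v) Taylor expansion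
  intro z
  have hT := hasSum_taylorCoeff_of_differentiableOn (hg.differentiableOn (s := ball 0 (‖z‖ + 1)))
    (lt_add_one ‖z‖)
  have hsingle : HasSum (fun n => iteratedDeriv n g 0 / n ! * z ^ n) (deriv g 0 * z) := by
    have := hasSum_single (f := fun n => iteratedDeriv n g 0 / n ! * z ^ n) 1 (fun n hn => ?_)
    · simpa using this
    · rcases Nat.lt_or_gt_of_ne hn with h | h
      · have : n = 0 := by omega
        subst this
        simp [h0]
      · rw [hvanish n (by omega)]
        simp
  exact hT.unique hsingle

end Edrei

/-! ### D. Edrei's Theorem 3 -/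

/-- **DISCHARGE of `edrei1952_exponential_factor`** (**Edrei's theorem**,
[AissenEdreiSchoenbergWhitney1951, Thm. 3]; Edrei 1952; [Edrei1953, §4]): if `g` is entire with
`g(0) = 0` and `e^{g}` has a (real) Pólya frequency Taylor sequence, then `g(z) = γ z` with
`γ ≥ 0`. Proof as in the module docstring (steps 1–4). [cite: AissenEdreiSchoenbergWhitney1951, Thm. 3] -/
theorem edrei1952_exponential_factor_holds : edrei1952_exponential_factor := by
  rintro g hg hg0 ⟨u, hu, hsum⟩
  -- 0. `u₀ = 1`, absolute convergence of `Σ uₙ zⁿ`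
  have hu0 : u 0 = 1 := by
    have h1 : HasSum (fun n => (u n : ℂ) * (0 : ℂ) ^ n) (u 0 : ℂ) := by
      have := hasSum_single (f := fun n => (u n : ℂ) * (0 : ℂ) ^ n) 0 (fun n hn => by simp [hn])
      simpa using this
    have h2 := h1.unique (hsum 0)
    rw [hg0, Complex.exp_zero] at h2
    exact_mod_cast h2
  have hSu : ∀ z : ℂ, Summable fun n => ‖(u n : ℂ) * z ^ n‖ := fun z =>
    summable_norm_of_hasSum (r := ‖z‖ + 1) (by positivity) (fun w _ => hsum w) (lt_add_one _)
  -- 1. `v = negRecipSeq u` is the Taylor sequence of `h(z) = e^{-g(-z)}`, everywhere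
  set v : ℕ → ℝ := negRecipSeq u with hvdef
  have hv : IsPolyaFrequencySeq v := hu.negRecipSeq hu0
  have hv0 : v 0 = 1 := negRecipSeq_zero hu0
  set h : ℂ → ℂ := fun z => Complex.exp (-g (-z)) with hhdef
  have hhd : Differentiable ℂ h := ((hg.comp differentiable_neg).neg).cexp
  obtain ⟨δ, hδ, hvnear⟩ :
      ∃ δ > 0, ∀ z : ℂ, ‖z‖ < δ → HasSum (fun n => (v n : ℂ) * z ^ n) (h z) := by
    have hsp : 0 ≤ stripPole v := stripPole_nonneg hv.isColumnPF
    refine ⟨(stripPole v + 1)⁻¹, inv_pos.2 (by linarith), fun z hz => ?_⟩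
    have hz1 : ‖z‖ * stripPole v < 1 := by
      calc ‖z‖ * stripPole v ≤ ‖z‖ * (stripPole v + 1) :=
            mul_le_mul_of_nonneg_left (by linarith) (norm_nonneg _)
        _ < (stripPole v + 1)⁻¹ * (stripPole v + 1) :=
            mul_lt_mul_of_pos_right hz (by linarith)
        _ = 1 := inv_mul_cancel₀ (by linarith)
    have hvS : Summable fun n => ‖(v n : ℂ) * z ^ n‖ :=
      summable_norm_mul_pow_of_stripPole hv.isColumnPF (by rw [hv0]; exact one_pos) hz1
    have hrS : Summable fun n => ‖(recipSeq u n : ℂ) * (-z) ^ n‖ :=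
      hvS.congr fun n => by rw [hvdef, negRecipSeq_mul_pow]
    have e1 := tsum_mul_tsum_recipSeq hu0 (hSu (-z)) hrS
    rw [(hsum (-z)).tsum_eq] at e1
    have hval : ∑' n, (v n : ℂ) * z ^ n = h z := by
      have h1 : ∑' n, (v n : ℂ) * z ^ n = ∑' n, (recipSeq u n : ℂ) * (-z) ^ n :=
        tsum_congr fun n => by rw [hvdef, negRecipSeq_mul_pow]
      rw [h1, hhdef]
      simp only
      rw [Complex.exp_neg]
      exact eq_inv_of_mul_eq_one_right e1
    rw [← hval]
    exact hvS.of_norm.hasSum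
  have hvsum : ∀ z : ℂ, HasSum (fun n => (v n : ℂ) * z ^ n) (h z) := by
    intro z
    have H := hasSum_taylorCoeff_of_differentiableOn
      (hhd.differentiableOn (s := ball 0 (‖z‖ + 1))) (lt_add_one ‖z‖)
    have hcoef : ∀ n, iteratedDeriv n h 0 / n ! = (v n : ℂ) := fun n =>
      taylorCoeff_eq_of_hasSum hδ hvnear n
    simpa only [hcoef] using H
  have hSv : ∀ z : ℂ, Summable fun n => ‖(v n : ℂ) * z ^ n‖ := fun z =>
    summable_norm_of_hasSum (r := ‖z‖ + 1) (by positivity) (fun w _ => hvsum w) (lt_add_one _)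
  -- 2. `w = u ⋆ v` is the Taylor sequence of `W = e^{G}`, `G(z) = g(z) - g(-z)`
  set w : ℕ → ℝ := conv u v with hwdef
  have hw : IsPolyaFrequencySeq w := hu.conv hv
  have hw0 : w 0 = 1 := by rw [hwdef, conv_apply_zero, hu0, hv0, mul_one]
  set G : ℂ → ℂ := fun z => g z - g (-z) with hGdef
  have hGd : Differentiable ℂ G := hg.sub (hg.comp differentiable_neg)
  have hG0 : G 0 = 0 := by simp [hGdef]
  have hGneg : ∀ z, G (-z) = -G z := fun z => by simp [hGdef]
  have hexpG : ∀ z, Complex.exp (G z) = Complex.exp (g z) * h z := fun z => by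
    rw [hhdef, hGdef]
    simp only
    rw [← Complex.exp_add, sub_eq_add_neg]
  have hwsum : ∀ z : ℂ, HasSum (fun n => (w n : ℂ) * z ^ n) (Complex.exp (G z)) := by
    intro z
    rw [hexpG]
    exact hasSum_conv (hsum z) (hvsum z) (hSu z) (hSv z)
  have hSw : ∀ z : ℂ, Summable fun n => ‖(w n : ℂ) * z ^ n‖ := fun z =>
    summable_norm_of_hasSum (r := ‖z‖ + 1) (by positivity) (fun w _ => hwsum w) (lt_add_one _)
  have hW : ∀ z : ℂ, ∑' n, (w n : ℂ) * z ^ n = Complex.exp (G z) := fun z => (hwsum z).tsum_eq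
  -- 3. Step 1: `cosh(m G z) = 0 ⇒ Re z = 0`
  have hcosh : ∀ m : ℕ, 0 < m → ∀ z : ℂ, Complex.cosh (m * G z) = 0 → z.re = 0 := by
    intro m _ z hz
    refine hw.re_eq_zero_of_pow_add_pow hw0 hSw m (z := z) ?_
    rw [hW z, hW (-z), hGneg, ← Complex.exp_nat_mul, ← Complex.exp_nat_mul, mul_neg]
    rw [Complex.cosh] at hz
    linear_combination (2 : ℂ) * hz
  -- 4. real-axis bookkeeping
  have hre_of : ∀ (c : ℕ → ℝ) (x : ℝ) (s : ℂ), HasSum (fun n => (c n : ℂ) * (x : ℂ) ^ n) s →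
      HasSum (fun n => c n * x ^ n) s.re ∧ s.im = 0 := by
    intro c x s hs
    have h1 : HasSum (fun n => ((c n : ℂ) * (x : ℂ) ^ n).re) s.re := by
      simpa only [Complex.reCLM_apply] using hs.mapL Complex.reCLM
    have h2 : HasSum (fun n => ((c n : ℂ) * (x : ℂ) ^ n).im) s.im := by
      simpa only [Complex.imCLM_apply] using hs.mapL Complex.imCLM
    have e1 : (fun n => ((c n : ℂ) * (x : ℂ) ^ n).re) = fun n => c n * x ^ n := by
      funext n
      rw [← Complex.ofReal_pow, ← Complex.ofReal_mul, Complex.ofReal_re]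
    have e2 : (fun n => ((c n : ℂ) * (x : ℂ) ^ n).im) = fun _ => (0 : ℝ) := by
      funext n
      rw [← Complex.ofReal_pow, ← Complex.ofReal_mul, Complex.ofReal_im]
    rw [e1] at h1
    rw [e2] at h2
    exact ⟨h1, (hasSum_zero.unique h2).symm⟩
  have hre_u : ∀ x : ℝ, HasSum (fun n => u n * x ^ n) (Complex.exp (g x)).re := fun x =>
    (hre_of u x _ (hsum x)).1
  have him_u : ∀ x : ℝ, (Complex.exp (g x)).im = 0 := fun x => (hre_of u x _ (hsum x)).2
  have hre_v : ∀ x : ℝ, HasSum (fun n => v n * x ^ n) (h x).re := fun x =>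
    (hre_of v x _ (hvsum x)).1
  have him_v : ∀ x : ℝ, (h x).im = 0 := fun x => (hre_of v x _ (hvsum x)).2
  have hre_w : ∀ x : ℝ, HasSum (fun n => w n * x ^ n) (Complex.exp (G x)).re := fun x =>
    (hre_of w x _ (hwsum x)).1
  -- `|e^{g(z)}| ≤ e^{g}(|z|) ≤ e^{g}(R)` (non-negative coefficients)
  have hnorm_f : ∀ z : ℂ, ‖Complex.exp (g z)‖ ≤ (Complex.exp (g (‖z‖ : ℂ))).re := by
    intro z
    rw [← (hsum z).tsum_eq, ← (hre_u ‖z‖).tsum_eq]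
    refine (norm_tsum_le_tsum_norm (hSu z)).trans (le_of_eq (tsum_congr fun n => ?_))
    rw [norm_mul, norm_pow, Complex.norm_real, Real.norm_of_nonneg (hu.nonneg n)]
  have hmono_f : ∀ x R : ℝ, 0 ≤ x → x ≤ R →
      (Complex.exp (g x)).re ≤ (Complex.exp (g R)).re := by
    intro x R hx hxR
    rw [← (hre_u x).tsum_eq, ← (hre_u R).tsum_eq]
    exact (hre_u x).summable.tsum_le_tsum
      (fun n => mul_le_mul_of_nonneg_left (pow_le_pow_left₀ hx hxR n) (hu.nonneg n))
      (hre_u R).summable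
  have hone_h : ∀ R : ℝ, 0 ≤ R → 1 ≤ (h R).re := by
    intro R hR
    have := le_hasSum (hre_v R) 0 (fun n _ => mul_nonneg (hv.nonneg n) (pow_nonneg hR n))
    simpa [hv0] using this
  have hprod : ∀ x : ℝ, (Complex.exp (G x)).re = (Complex.exp (g x)).re * (h x).re := by
    intro x
    rw [hexpG, Complex.mul_re, him_u, him_v, mul_zero, sub_zero]
  -- `Re g(z) ≤ ‖G(R)‖` for `‖z‖ < R`
  have hre_g : ∀ R, 0 < R → ∀ z : ℂ, ‖z‖ < R → (g z).re ≤ ‖G R‖ := by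
    intro R hR z hz
    have hpos : 0 ≤ (Complex.exp (g R)).re := by
      rw [← (hre_u R).tsum_eq]
      exact tsum_nonneg fun n => mul_nonneg (hu.nonneg n) (pow_nonneg hR.le n)
    have h1 : Real.exp ((g z).re) ≤ Real.exp ((G R).re) := by
      rw [← Complex.norm_exp, ← Complex.norm_exp]
      calc ‖Complex.exp (g z)‖ ≤ (Complex.exp (g (‖z‖ : ℂ))).re := hnorm_f z
        _ ≤ (Complex.exp (g R)).re := hmono_f _ _ (norm_nonneg _) hz.le
        _ ≤ (Complex.exp (g R)).re * (h R).re := le_mul_of_one_le_right hpos (hone_h R hR.le)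
        _ = (Complex.exp (G R)).re := (hprod R).symm
        _ ≤ ‖Complex.exp (G R)‖ := Complex.re_le_norm _
    exact (Real.exp_le_exp.1 h1).trans (Complex.re_le_norm _)
  -- `Re G(x) ≥ 0` for `x ≥ 0` (`|W(-x)| ≤ W(x)`)
  have hGre_nonneg : ∀ x : ℝ, 0 ≤ x → 0 ≤ (G x).re := by
    intro x hx
    have h1 : ‖Complex.exp (G (-(x : ℂ)))‖ ≤ ‖Complex.exp (G x)‖ := by
      calc ‖Complex.exp (G (-(x : ℂ)))‖ = ‖∑' n, (w n : ℂ) * (-(x : ℂ)) ^ n‖ := by rw [hW]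
        _ ≤ ∑' n, ‖(w n : ℂ) * (-(x : ℂ)) ^ n‖ := norm_tsum_le_tsum_norm (hSw _)
        _ = ∑' n, w n * x ^ n := tsum_congr fun n => by
            rw [norm_mul, norm_pow, norm_neg, Complex.norm_real, Complex.norm_real,
              Real.norm_of_nonneg (hw.nonneg n), Real.norm_of_nonneg hx]
        _ = (Complex.exp (G x)).re := (hre_w x).tsum_eq
        _ ≤ ‖Complex.exp (G x)‖ := Complex.re_le_norm _
    have h2 : (G (-(x : ℂ))).re = -(G x).re := by rw [hGneg]; simp
    rw [Complex.norm_exp, Complex.norm_exp, Real.exp_le_exp, h2] at h1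
    linarith
  -- 5. Step 3: the doubling bound `‖G(2r)‖ ≤ 3 ‖G(r)‖`
  have hdouble : ∀ r : ℝ, 0 < r → ‖G ((2 * r : ℝ) : ℂ)‖ ≤ 3 * ‖G (r : ℂ)‖ := by
    intro r hr
    rcases Edrei.re_ne_zero_or_const hGd hcosh with hne | hconst
    · refine Edrei.norm_le_three_mul_norm hr hGd.differentiableOn fun z hz => ?_
      have hzre : 0 < z.re := by
        rw [mem_ball, dist_eq_norm] at hz
        have h1 : (((2 * r : ℝ) : ℂ) - z).re ≤ ‖((2 * r : ℝ) : ℂ) - z‖ := Complex.re_le_norm _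
        rw [norm_sub_rev] at h1
        simp only [Complex.sub_re, Complex.ofReal_re] at h1
        linarith
      have h1 : 0 < (G (1 : ℂ)).re :=
        lt_of_le_of_ne (by simpa using hGre_nonneg 1 zero_le_one) (hne 1 (by simp)).symm
      exact Edrei.re_pos_of_re_ne_zero hGd.continuous hne (z₀ := 1) (by simp) h1 hzre
    · rw [hconst ((2 * r : ℝ) : ℂ), hconst (r : ℂ), hG0]
      simp
  -- 6. Step 4: `g(z) = γ z`
  have hlin := Edrei.eq_smul_of_re_le hg hg0 (fun R => ‖G (R : ℂ)‖) (fun R _ => norm_nonneg _)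
    (fun R hR => hdouble R hR) hre_g
  -- 7. `γ = u₁ ≥ 0`
  have hcoef : iteratedDeriv 1 (fun z => Complex.exp (g z)) 0 / (1 ! : ℕ) = (u 1 : ℂ) :=
    taylorCoeff_eq_of_hasSum (h := fun z => Complex.exp (g z)) one_pos (fun z _ => hsum z) 1
  have hγ : deriv g 0 = (u 1 : ℂ) := by
    rw [← hcoef, iteratedDeriv_one, Nat.factorial_one, Nat.cast_one, div_one]
    have hd : HasDerivAt (fun z => Complex.exp (g z)) (Complex.exp (g 0) * deriv g 0) 0 :=
      (hg 0).hasDerivAt.cexp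
    rw [hd.deriv, hg0, Complex.exp_zero, one_mul]
  refine ⟨u 1, hu.nonneg 1, fun z => ?_⟩
  rw [hlin z, hγ]

/-- **DISCHARGE of `aswe_edrei`** — the **Aissen–Schoenberg–Whitney–Edrei representation
theorem** ([Karlin1968, Ch. 8, Thm. 5.3] = [AissenEdreiSchoenbergWhitney1951, Thm. 4]): a real
sequence `(aₙ)` with `a₀ > 0` is a Pólya frequency sequence iff near `0`
`Σ aₙ wⁿ = C e^{γw} ∏(1 + αᵢw)/∏(1 - βᵢw)` with `C > 0`, `γ ≥ 0`, `αᵢ, βᵢ ≥ 0`, `Σ(αᵢ+βᵢ) < ∞`.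
Assembled from Thm. 1 (`IsPolyaFrequencySeq.of_hasASWERepresentation`), Thm. 2
(`asw1952_representation_holds`) and Thm. 3 (`edrei1952_exponential_factor_holds`).
[cite: Karlin1968, Ch. 8 Thm. 5.3] -/
theorem aswe_edrei_holds : aswe_edrei :=
  aswe_edrei_of_edrei edrei1952_exponential_factor_holds

end Literature.Analysis.TotalPositivity
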